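import Literature.MathematicalPhysics.QuantumLattice.TraceInequalities
import Literature.MathematicalPhysics.QuantumLattice.LieTrotter
import HarnessLib

/-!
# Discharges for `TraceInequalities` (Golden–Thompson, Bernstein, Petz via the Lie product formula) and the Koma–Tasaki trace bound

Sibling proof file of `Literature/MathematicalPhysics/QuantumLattice/TraceInequalities.lean`
(trunk T-QLATTICE, family `hubbard`; the trace toolkit of Koma–Tasaki, PRL 68 (1992) 3248,
proof of eq. (10)). That file proves inequalities i)–iii) and reduces its four named facts to
the single input `lieTrotter_productFormula`; the Lie product formula itself is proved, in a
general Banach algebra, in `LieTrotter.lean` (`Literature.MathematicalPhysics.QuantumLattice.tendsto_lieTrotter`). This file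
specialises it to matrices, so discharging all four facts, and then proves the abstract matrix
form of Koma–Tasaki's eqs. (6), (10)–(11) (`koma_tasaki_trace_bound`), the common input of the
three consumers `HubbardHubbardModelPairDecayProofs` (`koma_tasaki_2d_holds`),
`HubbardHubbardModelKomaTasakiProofs` (`koma_tasaki_magnetic_holds`, `koma_tasaki_1d_holds`) and
`HubbardKomaTasakiNoLROProofs` (`koma_tasaki_noLRO_holds`). No definition and no statement is
introduced or changed here.

History: this module was first landed by p7441 (agent `…koma_tasaki_magnetic-0`) and
inadvertently replaced by p8796 (agent `…koma_tasaki_noLRO-0`, a narrower file at the same path);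
the present version is the union: every declaration recorded for p7441 is present with the
recorded name and statement (`lieTrotter_productFormula_holds`, `petz_norm_trace_exp_add_le_holds`,
`goldenThompson_holds`, `bernstein_trace_exp_mul_exp_conjTranspose_le_holds`,
`posSemidef_exp_of_isHermitian`, `norm_trace_mul_le_opNorm_mul_re_trace`,
`isHermitian_real_smul`, `koma_tasaki_trace_bound`), together with those of p8796
(`norm_trace_exp_add_I_smul_le`) and the intermediate steps of the chain.

Proved here:

* `lieTrotter_productFormula_holds` — `(e^{A/s} e^{B/s})^s → e^{A+B}` for square matrices over
  `ℝ` or `ℂ` (Petz 1994, Lemma 4; Bernstein 2009, Cor. 11.4.8; Reed–Simon I, Thm VIII.29), hence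
  `petz_norm_trace_exp_add_le_holds` (Petz, Theorem 5), `goldenThompson_holds`,
  `bernstein_trace_exp_mul_exp_conjTranspose_le_holds`, `norm_trace_exp_add_I_smul_le`
  (Petz, Corollary 6);
* `posSemidef_exp_of_isHermitian` (`e^A ≥ 0` for Hermitian `A`), `isHermitian_real_smul`;
* `norm_star_dotProduct_mulVec_le` (`|x⋆ ⬝ O x| ≤ ‖O‖ · x⋆ ⬝ x`, `ℓ²` operator norm) and
  **inequality ii) in operator-norm form** for an ARBITRARY `O`:
  `norm_trace_mul_le_opNorm_mul_re_trace`, `|Tr (O P)| ≤ ‖O‖ Tr P` for `P ≥ 0`;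
* the chain of eq. (10): `norm_trace_mul_exp_le_re_trace` (Schwarz + ii):
  `|Tr[A e^{2bK}]| ≤ Tr[e^{bK} e^{bK⋆}]` for `‖A‖ ≤ 1`),
  `norm_trace_mul_exp_le_of_hermitianPart_le` (Bernstein, Golden–Thompson, ii):
  `|Tr[A e^{-β(H+D)}]| ≤ e^{βs} Tr[e^{-βH}]` if `‖(D + Dᴴ)/2‖ ≤ s`),
  `norm_trace_mul_exp_le_of_gauge` (with eq. (6): `G A G⁻¹ = a A`, `G H G⁻¹ = H + D` give
  `|Tr[A e^{-βH}]| ≤ |a| e^{βs} Tr[e^{-βH}]`), and its normalised form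
  `koma_tasaki_trace_bound`:
  `|Tr[A e^{-H}]| ≤ |κ| ‖A‖ exp ‖(G H G⁻¹ + (G H G⁻¹)ᴴ)/2 - H‖ · Tr[e^{-H}]`.

## Sources

* T. Koma, H. Tasaki, PRL **68** (1992) 3248 = arXiv:cond-mat/9709068, p. 4, eq. (10):
  "`|Tr[G A G⁻¹ exp[-β G H G⁻¹]]| ≤ e^{-2(φ_x-φ_y)} (‖A⋆A‖)^{1/2} Tr[e^{-(βGHG⁻¹)/2} e^{-(βG⁻¹HG)/2}]`
  `≤ e^{-2(φ_x-φ_y)} Tr[e^{-β(H+U)}] ≤ e^{-2(φ_x-φ_y)} ‖e^{βU}‖ Tr[e^{βH}]`", proved with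
  "i) the Schwartz inequality … ii) `|Tr[OP]| ≤ ‖O‖ Tr[P]` with `O` hermitian and `P` positive
  … iii) `Tr[(O⋆)^N O^N] ≤ Tr[(O⋆O)^N]` … iv) the Golden–Symanzik–Thompson inequality", and
  eq. (11): "`‖e^{-βU}‖ ≤ exp[β Σ |t_{u,v}[cosh(φ_u-φ_v)-1]|]`".
* D. Petz, *A survey of certain trace inequalities*, Banach Center Publ. **30** (1994) 287–298,
  Lemma 4 (held copy, p. 290), Theorem 5, eq. (8), Theorem 10, Corollary 6.
* D. S. Bernstein, *Matrix Mathematics*, 2nd ed. (2009), Corollary 11.4.8 (held copy, PDF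
  p. 658), Fact 11.15.4, Fact 11.16.4.

## Design notes

* The matrix algebra `Matrix n n 𝕜` carries no global norm; the product formula of `LieTrotter`
  is applied in the `ℓ^∞`-operator normed algebra structure (`Matrix.Norms.Operator`), whereas
  all norm BOUNDS below are in the `ℓ²` operator norm of the scoped `Matrix.Norms.L2Operator`
  (Koma–Tasaki's `‖O‖`, "the maximum of the absolute values of the eigenvalues" for Hermitian
  `O`); the Löwner order is Mathlib's scoped `MatrixOrder`; `exp` is `NormedSpace.exp`.
* `n` is nonempty where `‖1‖ = 1` is used (`‖e^X‖ ≤ e^{‖X‖}`, `LieTrotter.norm_exp_le`);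
  `koma_tasaki_trace_bound` itself has no such hypothesis (both sides vanish for empty `n`).
-/

noncomputable section

namespace Literature.MathematicalPhysics.QuantumLattice

open Filter Topology NormedSpace Matrix
open scoped ComplexOrder MatrixOrder Matrix.Norms.L2Operator InnerProductSpace

/-! ### Discharges -/

section Discharges

variable {𝕜 : Type*} [RCLike 𝕜] {n : Type*} [Fintype n] [DecidableEq n]

/-- **Discharge of `lieTrotter_productFormula`** (Petz 1994, Lemma 4; Bernstein 2009,
Cor. 11.4.8): the general product formula `tendsto_lieTrotter` of `LieTrotter` in the
`ℓ^∞`-operator normed algebra structure on `Matrix n n 𝕜` (`Matrix.Norms.Operator`; its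
topology is the entrywise one, and `‖1‖ = 1` for nonempty `n`, the empty case being trivial).
[cite: Petz1994, Lemma 4] [cite: Bernstein2009, Corollary 11.4.8] -/
theorem lieTrotter_productFormula_holds : lieTrotter_productFormula (𝕜 := 𝕜) (n := n) := by
  intro A B
  cases isEmpty_or_nonempty n with
  | inl h =>
    rw [Subsingleton.elim (exp (A + B)) 0]
    exact tendsto_const_nhds.congr fun s => Subsingleton.elim _ _
  | inr h =>
    open scoped Matrix.Norms.Operator in
    exact tendsto_lieTrotter (𝕂 := 𝕜) A B

/-- **Discharge of Petz's Theorem 5** (`petz_of_lieTrotter` and the product formula).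
Petz, Banach Center Publ. 30 (1994) 287, Theorem 5. [cite: Petz1994, Theorem 5] -/
theorem petz_norm_trace_exp_add_le_holds : petz_norm_trace_exp_add_le (𝕜 := 𝕜) (n := n) :=
  petz_of_lieTrotter lieTrotter_productFormula_holds

/-- **Discharge of the Golden–Thompson inequality** `Tr e^{A+B} ≤ Tr e^A e^B` for Hermitian
`A, B` (`goldenThompson_of_petz`). Petz, Banach Center Publ. 30 (1994) 287, eq. (8);
Bernstein, *Matrix Mathematics* (2009), Fact 11.16.4; Koma–Tasaki, PRL 68 (1992) 3248, proof of
eq. (10), iv). [cite: Petz1994, eq. (8)] [cite: Bernstein2009, Fact 11.16.4] -/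
theorem goldenThompson_holds : goldenThompson (𝕜 := 𝕜) (n := n) :=
  goldenThompson_of_petz petz_norm_trace_exp_add_le_holds

/-- **Discharge of Bernstein's inequality** `Tr e^K e^{K⋆} ≤ Tr e^{K+K⋆}`
(`bernstein_of_lieTrotter`). Petz, Banach Center Publ. 30 (1994) 287, Theorem 10; Bernstein,
*Matrix Mathematics* (2009), Fact 11.15.4. [cite: Petz1994, Theorem 10]
[cite: Bernstein2009, Fact 11.15.4] -/
theorem bernstein_trace_exp_mul_exp_conjTranspose_le_holds :
    bernstein_trace_exp_mul_exp_conjTranspose_le (𝕜 := 𝕜) (n := n) :=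
  bernstein_of_lieTrotter lieTrotter_productFormula_holds

/-- **Petz (1994), Corollary 6**, unconditionally: for Hermitian complex matrices `A, B`,
`|Tr e^{A+iB}| ≤ Tr e^A`. Petz, Banach Center Publ. 30 (1994) 287, Corollary 6.
[cite: Petz1994, Corollary 6] -/
theorem norm_trace_exp_add_I_smul_le {m : Type*} [Fintype m] [DecidableEq m]
    (A B : Matrix m m ℂ) (hA : A.IsHermitian) (hB : B.IsHermitian) :
    ‖(exp (A + Complex.I • B)).trace‖ ≤ (exp A).trace.re :=
  norm_trace_exp_add_I_smul_le_of_petz petz_norm_trace_exp_add_le_holds A B hA hB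

end Discharges

/-! ### Hermitian matrices: real multiples, positivity of the exponential -/

section HermitianAPI

variable {n : Type*} [Fintype n] [DecidableEq n]

omit [Fintype n] [DecidableEq n] in
/-- A real multiple of a Hermitian matrix is Hermitian. [folklore] -/
theorem isHermitian_real_smul {A : Matrix n n ℂ} (hA : A.IsHermitian) (r : ℝ) :
    ((r : ℂ) • A).IsHermitian := by
  unfold Matrix.IsHermitian
  rw [conjTranspose_smul, hA.eq, Complex.star_def, Complex.conj_ofReal]

/-- `e^A ≥ 0` (positive semidefinite) for Hermitian `A`: `e^A = (e^{A/2})ᴴ e^{A/2}`.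
Petz, Banach Center Publ. 30 (1994) 287, §1 ("`e^H` is positive for self-adjoint `H`").
[folklore] -/
theorem posSemidef_exp_of_isHermitian {A : Matrix n n ℂ} (hA : A.IsHermitian) :
    (exp A).PosSemidef := by
  set B : Matrix n n ℂ := ((1 / 2 : ℝ) : ℂ) • A with hB
  have hBA : B + B = A := by
    rw [hB, ← add_smul, ← Complex.ofReal_add]
    norm_num
  have hBh : B.IsHermitian := isHermitian_real_smul hA (1 / 2)
  have hBc : (exp B)ᴴ = exp B := by
    rw [← exp_conjTranspose, hBh.eq]
  have h := posSemidef_conjTranspose_mul_self (exp B)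
  rw [hBc] at h
  rw [← hBA, Matrix.exp_add_of_commute B B (Commute.refl B)]
  exact h

/-! ### Inequality ii) in operator-norm form, for an arbitrary `O` -/

/-- `|x⋆ ⬝ O x| ≤ ‖O‖ · (x⋆ ⬝ x)` for the `ℓ²` operator norm (Cauchy–Schwarz in `ℓ²(n)`:
`|⟨x, O x⟩| ≤ ‖x‖ ‖O x‖ ≤ ‖O‖ ‖x‖²`). [folklore] -/
theorem norm_star_dotProduct_mulVec_le (O : Matrix n n ℂ) (x : n → ℂ) :
    ‖star x ⬝ᵥ (O *ᵥ x)‖ ≤ ‖O‖ * (star x ⬝ᵥ x).re := by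
  set v : EuclideanSpace ℂ n := WithLp.toLp 2 x with hv
  have hinner : star x ⬝ᵥ (O *ᵥ x) = ⟪v, toEuclideanCLM (n := n) (𝕜 := ℂ) O v⟫_ℂ := by
    rw [hv, toEuclideanCLM_toLp, EuclideanSpace.inner_toLp_toLp, dotProduct_comm]
  have hself : (star x ⬝ᵥ x).re = ‖v‖ ^ 2 := by
    have h : star x ⬝ᵥ x = ⟪v, v⟫_ℂ := by
      rw [hv, EuclideanSpace.inner_toLp_toLp, dotProduct_comm]
    rw [h, inner_self_eq_norm_sq_to_K]
    norm_cast
  rw [hinner, hself]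
  calc ‖⟪v, toEuclideanCLM (n := n) (𝕜 := ℂ) O v⟫_ℂ‖
      ≤ ‖v‖ * ‖toEuclideanCLM (n := n) (𝕜 := ℂ) O v‖ := norm_inner_le_norm _ _
    _ ≤ ‖v‖ * (‖toEuclideanCLM (n := n) (𝕜 := ℂ) O‖ * ‖v‖) := by
        gcongr
        exact ContinuousLinearMap.le_opNorm _ _
    _ = ‖O‖ * ‖v‖ ^ 2 := by
        rw [l2_opNorm_toEuclideanCLM]
        ring

/-- **Inequality ii) in operator-norm form**, for an arbitrary (not necessarily Hermitian) `O`
and `P ≥ 0`: `|Tr (O P)| ≤ ‖O‖ Tr P` (`ℓ²` operator norm). Writing `P = Bᴴ B`,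
`Tr (O P) = Tr (B O Bᴴ) = Σ_i x_i⋆ ⬝ O x_i` with `x_i` the conjugate rows of `B`, and
`Σ_i x_i⋆ ⬝ x_i = Tr (B Bᴴ) = Tr P`. Koma–Tasaki, PRL 68 (1992) 3248, proof of eq. (10), ii)
("`|Tr[OP]| ≤ ‖O‖ Tr[P]` with `O` hermitian and `P` positive"; hermiticity is not needed).
[cite: KomaTasakiPRL1992, proof of eq. (10), inequality ii)] -/
theorem norm_trace_mul_le_opNorm_mul_re_trace (O : Matrix n n ℂ) {P : Matrix n n ℂ}
    (hP : P.PosSemidef) : ‖(O * P).trace‖ ≤ ‖O‖ * (P.trace).re := by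
  -- `P = Bᴴ B` with `B = √P` (Hermitian, `√P √P = P`)
  obtain ⟨B, rfl⟩ : ∃ B : Matrix n n ℂ, P = Bᴴ * B := by
    refine ⟨CFC.sqrt P, ?_⟩
    have hSh : (CFC.sqrt P)ᴴ = CFC.sqrt P :=
      (Matrix.nonneg_iff_posSemidef.1 (CFC.sqrt_nonneg P)).1.eq
    rw [hSh, CFC.sqrt_mul_sqrt_self P hP.nonneg]
  -- `Tr (O Bᴴ B) = Tr (B O Bᴴ) = Σ_i (B O Bᴴ) i i`, and `(B O Bᴴ) i i = x_i⋆ ⬝ O x_i`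
  have hcyc : (O * (Bᴴ * B)).trace = (B * O * Bᴴ).trace := by
    rw [← Matrix.mul_assoc, trace_mul_cycle]
  have hdiag : ∀ i, (B * O * Bᴴ) i i = star (star (B i)) ⬝ᵥ (O *ᵥ star (B i)) := by
    intro i
    rw [star_star, Matrix.mul_assoc, Matrix.mul_apply]
    simp only [dotProduct, mulVec, Matrix.mul_apply, conjTranspose_apply, Pi.star_apply]
  have hdiagP : ∀ i, (B * Bᴴ) i i = star (star (B i)) ⬝ᵥ star (B i) := by
    intro i
    rw [star_star, Matrix.mul_apply]
    simp only [dotProduct, conjTranspose_apply, Pi.star_apply]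
  have htrP : (Bᴴ * B).trace.re = ∑ i, (star (star (B i)) ⬝ᵥ star (B i)).re := by
    rw [trace_mul_comm, Matrix.trace]
    simp only [Matrix.diag_apply, hdiagP, Complex.re_sum]
  rw [hcyc, Matrix.trace, htrP, Finset.mul_sum]
  simp only [Matrix.diag_apply, hdiag]
  exact (norm_sum_le _ _).trans (Finset.sum_le_sum fun i _ => norm_star_dotProduct_mulVec_le O _)

end HermitianAPI

/-! ### The Koma–Tasaki chain (eqs. (6), (10)–(11)) -/

section KomaTasaki

variable {n : Type*} [Fintype n] [DecidableEq n]

/-- **Step (10), first two inequalities**: for any `K` and any `A` with `‖A‖ ≤ 1`,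
`|Tr[A e^{2bK}]| ≤ Tr[e^{bK} (e^{bK})ᴴ]` (cyclicity, Schwarz i) and ii) with `‖A Aᴴ‖ ≤ 1`;
the right-hand side is `Tr[W Wᴴ] ≥ 0`, `W = e^{bK}`; in print `b = -β/2`).
Koma–Tasaki, PRL 68 (1992) 3248, eq. (10). [cite: KomaTasakiPRL1992, eq. (10)] -/
theorem norm_trace_mul_exp_le_re_trace (K A : Matrix n n ℂ) (hA : ‖A‖ ≤ 1) (b : ℂ) :
    ‖(A * exp ((b + b) • K)).trace‖ ≤ (exp (b • K) * (exp (b • K))ᴴ).trace.re := by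
  set W := exp (b • K) with hW
  have hsplit : exp ((b + b) • K) = W * W := by
    rw [add_smul, Matrix.exp_add_of_commute _ _ (Commute.refl _ |>.smul_left b |>.smul_right b)]
  have hP : (Wᴴ * W).PosSemidef := posSemidef_conjTranspose_mul_self W
  have hAAn : ‖A * Aᴴ‖ ≤ 1 := by
    calc ‖A * Aᴴ‖ ≤ ‖A‖ * ‖Aᴴ‖ := l2_opNorm_mul _ _
      _ ≤ 1 * 1 := by
          rw [l2_opNorm_conjTranspose]
          exact mul_le_mul hA hA (norm_nonneg _) zero_le_one
      _ = 1 := one_mul 1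
  -- cyclicity: Tr[A W W] = Tr[(W A) W]
  have hcyc : (A * exp ((b + b) • K)).trace = (W * A * W).trace := by
    rw [hsplit, ← Matrix.mul_assoc, trace_mul_cycle, Matrix.mul_assoc]
  -- Schwarz
  have hS := norm_trace_mul_le (W * A) W
  -- ii): Tr[(WA)ᴴ (WA)] = Tr[(A Aᴴ)(Wᴴ W)] ≤ ‖A Aᴴ‖ Tr[Wᴴ W] ≤ Tr[Wᴴ W]
  have hw0 : 0 ≤ RCLike.re (Wᴴ * W).trace := re_trace_nonneg_of_posSemidef hP
  have hii : RCLike.re ((W * A)ᴴ * (W * A)).trace ≤ RCLike.re (Wᴴ * W).trace := by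
    have hc2 : ((W * A)ᴴ * (W * A)).trace = (A * Aᴴ * (Wᴴ * W)).trace := by
      rw [conjTranspose_mul, show Aᴴ * Wᴴ * (W * A) = Aᴴ * (Wᴴ * W) * A by
        simp only [Matrix.mul_assoc], trace_mul_cycle]
    have h := norm_trace_mul_le_opNorm_mul_re_trace (A * Aᴴ) hP
    rw [hc2]
    refine (RCLike.re_le_norm _).trans (h.trans ?_)
    calc ‖A * Aᴴ‖ * (Wᴴ * W).trace.re ≤ 1 * (Wᴴ * W).trace.re :=
          mul_le_mul_of_nonneg_right hAAn hw0
      _ = RCLike.re (Wᴴ * W).trace := one_mul _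
  calc ‖(A * exp ((b + b) • K)).trace‖ = ‖(W * A * W).trace‖ := by rw [hcyc]
    _ ≤ √(RCLike.re ((W * A)ᴴ * (W * A)).trace) * √(RCLike.re (Wᴴ * W).trace) := hS
    _ ≤ √(RCLike.re (Wᴴ * W).trace) * √(RCLike.re (Wᴴ * W).trace) := by
        gcongr
    _ = RCLike.re (Wᴴ * W).trace := Real.mul_self_sqrt hw0
    _ = (exp (b • K) * (exp (b • K))ᴴ).trace.re := by
        rw [trace_mul_comm]
        rfl

/-- **Steps (10)–(11)**: if `K = H + D` with `H` Hermitian and `‖(D + Dᴴ)/2‖ ≤ s`, then for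
`β ≥ 0` and `‖A‖ ≤ 1`, `|Tr[A e^{-βK}]| ≤ e^{βs} Tr[e^{-βH}]` (Bernstein:
`Tr[e^{-βK/2} e^{-βK⋆/2}] ≤ Tr[e^{-β(H+U)}]`, `U = (D + Dᴴ)/2`; Golden–Thompson:
`≤ Tr[e^{-βH} e^{-βU}]`; ii): `≤ ‖e^{-βU}‖ Tr[e^{-βH}] ≤ e^{β‖U‖} Tr[e^{-βH}]`).
Koma–Tasaki, PRL 68 (1992) 3248, eqs. (10)–(11). [cite: KomaTasakiPRL1992, eqs. (10)–(11)] -/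
theorem norm_trace_mul_exp_le_of_hermitianPart_le [Nonempty n] {H D A : Matrix n n ℂ}
    (hH : H.IsHermitian) {β s : ℝ} (hβ : 0 ≤ β) (hD : ‖(2 : ℂ)⁻¹ • (D + Dᴴ)‖ ≤ s)
    (hA : ‖A‖ ≤ 1) :
    ‖(A * exp (-(β : ℂ) • (H + D))).trace‖ ≤
      Real.exp (β * s) * (exp (-(β : ℂ) • H)).trace.re := by
  set U : Matrix n n ℂ := (2 : ℂ)⁻¹ • (D + Dᴴ) with hU
  have hUh : U.IsHermitian := by
    unfold Matrix.IsHermitian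
    rw [hU, conjTranspose_smul, conjTranspose_add, conjTranspose_conjTranspose, add_comm]
    congr 1
    rw [Complex.star_def, map_inv₀, map_ofNat]
  have hnegH : (-(β : ℂ) • H).IsHermitian := by
    have h := isHermitian_real_smul hH (-β)
    rwa [Complex.ofReal_neg] at h
  have hnegU : (-(β : ℂ) • U).IsHermitian := by
    have h := isHermitian_real_smul hUh (-β)
    rwa [Complex.ofReal_neg] at h
  set b : ℂ := -((β / 2 : ℝ) : ℂ) with hb
  have hbb : b + b = -(β : ℂ) := by
    rw [hb]
    push_cast
    ring
  -- (10): Schwarz + ii)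
  have h10 := norm_trace_mul_exp_le_re_trace (H + D) A hA b
  rw [hbb] at h10
  -- Bernstein: Tr[e^X e^{Xᴴ}] ≤ Tr[e^{X + Xᴴ}], X = b(H + D), X + Xᴴ = -βH + -βU
  set X : Matrix n n ℂ := b • (H + D) with hX
  have hXX : X + Xᴴ = -(β : ℂ) • H + -(β : ℂ) • U := by
    have hbstar : star b = b := by
      rw [hb, star_neg, Complex.star_def, Complex.conj_ofReal]
    rw [hX, hU, conjTranspose_smul, hbstar, conjTranspose_add, hH.eq, hb]
    ext i j
    simp only [Matrix.add_apply, Matrix.smul_apply, smul_eq_mul]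
    push_cast
    ring
  have hBern := bernstein_trace_exp_mul_exp_conjTranspose_le_holds X
  rw [hXX] at hBern
  -- Golden–Thompson
  have hGT := goldenThompson_holds (-(β : ℂ) • H) (-(β : ℂ) • U) hnegH hnegU
  -- ii) with ‖e^{-βU}‖ ≤ e^{βs}
  have hP : (exp (-(β : ℂ) • H)).PosSemidef := posSemidef_exp_of_isHermitian hnegH
  have hOn : ‖exp (-(β : ℂ) • U)‖ ≤ Real.exp (β * s) := by
    refine (norm_exp_le ℂ _).trans (Real.exp_le_exp.2 ?_)
    rw [norm_smul, norm_neg, Complex.norm_real, Real.norm_eq_abs, abs_of_nonneg hβ]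
    exact mul_le_mul_of_nonneg_left hD hβ
  have hii := norm_trace_mul_le_opNorm_mul_re_trace (exp (-(β : ℂ) • U)) hP
  have htr0 : 0 ≤ (exp (-(β : ℂ) • H)).trace.re := re_trace_nonneg_of_posSemidef hP
  -- assemble
  calc ‖(A * exp (-(β : ℂ) • (H + D))).trace‖
      ≤ (exp X * (exp X)ᴴ).trace.re := h10
    _ = RCLike.re (exp X * exp Xᴴ).trace := by rw [exp_conjTranspose]; rfl
    _ ≤ RCLike.re (exp (-(β : ℂ) • H + -(β : ℂ) • U)).trace := hBern
    _ ≤ RCLike.re (exp (-(β : ℂ) • H) * exp (-(β : ℂ) • U)).trace := hGT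
    _ = (exp (-(β : ℂ) • U) * exp (-(β : ℂ) • H)).trace.re := by rw [trace_mul_comm]; rfl
    _ ≤ ‖(exp (-(β : ℂ) • U) * exp (-(β : ℂ) • H)).trace‖ := Complex.re_le_norm _
    _ ≤ ‖exp (-(β : ℂ) • U)‖ * (exp (-(β : ℂ) • H)).trace.re := hii
    _ ≤ Real.exp (β * s) * (exp (-(β : ℂ) • H)).trace.re :=
        mul_le_mul_of_nonneg_right hOn htr0

/-- **The Koma–Tasaki trace bound with eq. (6)**: let `H` be Hermitian, `G` invertible with
`G A G⁻¹ = a A` and `G H G⁻¹ = H + D`, `‖(D + Dᴴ)/2‖ ≤ s`, `‖A‖ ≤ 1`, `β ≥ 0`. Then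
`|Tr[A e^{-βH}]| ≤ |a| e^{βs} Tr[e^{-βH}]`, since `Tr[A e^{-βH}] = Tr[(GAG⁻¹) e^{-βGHG⁻¹}]`
(invariance of the trace under conjugation, `Matrix.exp_units_conj`).
Koma–Tasaki, PRL 68 (1992) 3248, eqs. (6), (10)–(11). [cite: KomaTasakiPRL1992, eqs. (6), (10)–(11)] -/
theorem norm_trace_mul_exp_le_of_gauge [Nonempty n] {H D A : Matrix n n ℂ}
    (G : (Matrix n n ℂ)ˣ) {a : ℂ} (hH : H.IsHermitian) {β s : ℝ} (hβ : 0 ≤ β)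
    (hGA : (G : Matrix n n ℂ) * A * ((G⁻¹ : (Matrix n n ℂ)ˣ) : Matrix n n ℂ) = a • A)
    (hGH : (G : Matrix n n ℂ) * H * ((G⁻¹ : (Matrix n n ℂ)ˣ) : Matrix n n ℂ) = H + D)
    (hD : ‖(2 : ℂ)⁻¹ • (D + Dᴴ)‖ ≤ s) (hA : ‖A‖ ≤ 1) :
    ‖(A * exp (-(β : ℂ) • H)).trace‖ ≤
      ‖a‖ * Real.exp (β * s) * (exp (-(β : ℂ) • H)).trace.re := by
  -- eq. (6): Tr[A e^{-βH}] = Tr[(G A G⁻¹) (G e^{-βH} G⁻¹)] = a Tr[A e^{-β(H+D)}]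
  have hconjExp : (G : Matrix n n ℂ) * exp (-(β : ℂ) • H) * ((G⁻¹ : (Matrix n n ℂ)ˣ) : Matrix n n ℂ) =
      exp (-(β : ℂ) • (H + D)) := by
    rw [← Matrix.exp_units_conj, Matrix.mul_smul, Matrix.smul_mul, hGH]
  have h6 : (A * exp (-(β : ℂ) • H)).trace = a * (A * exp (-(β : ℂ) • (H + D))).trace := by
    calc (A * exp (-(β : ℂ) • H)).trace
        = ((G : Matrix n n ℂ) * (A * exp (-(β : ℂ) • H)) *
            ((G⁻¹ : (Matrix n n ℂ)ˣ) : Matrix n n ℂ)).trace := (trace_units_conj G _).symm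
      _ = (((G : Matrix n n ℂ) * A * ((G⁻¹ : (Matrix n n ℂ)ˣ) : Matrix n n ℂ)) *
            ((G : Matrix n n ℂ) * exp (-(β : ℂ) • H) *
              ((G⁻¹ : (Matrix n n ℂ)ˣ) : Matrix n n ℂ))).trace := by
          congr 1
          simp only [Matrix.mul_assoc, Units.inv_mul_cancel_left]
      _ = a * (A * exp (-(β : ℂ) • (H + D))).trace := by
          rw [hGA, hconjExp, Matrix.smul_mul, trace_smul, smul_eq_mul]
  rw [h6, norm_mul, mul_assoc]
  exact mul_le_mul_of_nonneg_left (norm_trace_mul_exp_le_of_hermitianPart_le hH hβ hD hA)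
    (norm_nonneg a)

/-- **The Koma–Tasaki trace bound** (matrix form of eqs. (6), (10), (11)), normalised form:
for `H` Hermitian, `G` invertible and `G A G⁻¹ = κ A`,
`|Tr[A e^{-H}]| ≤ |κ| ‖A‖ exp ‖(G H G⁻¹ + (G H G⁻¹)ᴴ)/2 - H‖ · Tr[e^{-H}]`
(`(G H G⁻¹ + (G H G⁻¹)ᴴ)/2 - H` is the Hermitian part `U` of `G H G⁻¹ - H = U + iP`, eq. (9);
apply it to `βH`). Koma–Tasaki, PRL 68 (1992) 3248, eqs. (6), (10), (11).
[cite: KomaTasakiPRL1992, eqs. (6), (10), (11)] -/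
theorem koma_tasaki_trace_bound {H : Matrix n n ℂ} (hH : H.IsHermitian) (G : (Matrix n n ℂ)ˣ)
    (A : Matrix n n ℂ) (κ : ℂ)
    (hA : (G : Matrix n n ℂ) * A * ((G⁻¹ : (Matrix n n ℂ)ˣ) : Matrix n n ℂ) = κ • A) :
    ‖(A * exp (-H)).trace‖ ≤
      ‖κ‖ * ‖A‖ *
        Real.exp ‖(2 : ℂ)⁻¹ • (((G : Matrix n n ℂ) * H * ((G⁻¹ : (Matrix n n ℂ)ˣ) : Matrix n n ℂ)) +
          ((G : Matrix n n ℂ) * H * ((G⁻¹ : (Matrix n n ℂ)ˣ) : Matrix n n ℂ))ᴴ) - H‖ *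
        ((exp (-H)).trace).re := by
  cases isEmpty_or_nonempty n with
  | inl hn =>
    -- both traces vanish on the empty index type
    simp [Matrix.trace]
  | inr hn =>
    -- the conjugated Hamiltonian `K = G H G⁻¹ = H + D`, `D = K - H`, with Hermitian part `U`
    set K : Matrix n n ℂ := (G : Matrix n n ℂ) * H * ((G⁻¹ : (Matrix n n ℂ)ˣ) : Matrix n n ℂ)
      with hK
    set D : Matrix n n ℂ := K - H with hDdef
    have hGH : (G : Matrix n n ℂ) * H * ((G⁻¹ : (Matrix n n ℂ)ˣ) : Matrix n n ℂ) = H + D := by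
      rw [hDdef, add_sub_cancel]
    have hU : (2 : ℂ)⁻¹ • (D + Dᴴ) = (2 : ℂ)⁻¹ • (K + Kᴴ) - H := by
      rw [hDdef, conjTranspose_sub, hH.eq]
      module
    have hD : ‖(2 : ℂ)⁻¹ • (D + Dᴴ)‖ ≤ ‖(2 : ℂ)⁻¹ • (K + Kᴴ) - H‖ := by rw [hU]
    -- normalise the observable
    by_cases hA0 : A = 0
    · subst hA0
      simp
    have hApos : 0 < ‖A‖ := norm_pos_iff.2 hA0
    set A' : Matrix n n ℂ := ((‖A‖⁻¹ : ℝ) : ℂ) • A with hA'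
    have hA'1 : ‖A'‖ ≤ 1 := by
      rw [hA', norm_smul, Complex.norm_real, Real.norm_of_nonneg (inv_nonneg.2 hApos.le),
        inv_mul_cancel₀ hApos.ne']
    have hGA' : (G : Matrix n n ℂ) * A' * ((G⁻¹ : (Matrix n n ℂ)ˣ) : Matrix n n ℂ) = κ • A' := by
      rw [hA', Matrix.mul_smul, Matrix.smul_mul, hA, smul_comm]
    have hAA' : A = ((‖A‖ : ℝ) : ℂ) • A' := by
      rw [hA', smul_smul, ← Complex.ofReal_mul, mul_inv_cancel₀ hApos.ne', Complex.ofReal_one,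
        one_smul]
    have key := norm_trace_mul_exp_le_of_gauge G hH zero_le_one hGA' hGH hD hA'1
    simp only [Complex.ofReal_one, one_mul] at key
    -- `-(1 : ℂ) • M = -M`
    rw [neg_smul, one_smul] at key
    calc ‖(A * exp (-H)).trace‖ = ‖A‖ * ‖(A' * exp (-H)).trace‖ := by
          conv_lhs => rw [hAA']
          rw [Matrix.smul_mul, trace_smul, norm_smul, Complex.norm_real, Real.norm_of_nonneg
            hApos.le]
      _ ≤ ‖A‖ * (‖κ‖ * Real.exp ‖(2 : ℂ)⁻¹ • (K + Kᴴ) - H‖ * (exp (-H)).trace.re) :=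
          mul_le_mul_of_nonneg_left key hApos.le
      _ = ‖κ‖ * ‖A‖ * Real.exp ‖(2 : ℂ)⁻¹ • (K + Kᴴ) - H‖ * (exp (-H)).trace.re := by ring

end KomaTasaki

end Literature.MathematicalPhysics.QuantumLattice
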